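import Summits.QuantumFields.YangMills.Theorems.BalabanUVNodesN15KingModelCombesThomasFormBound
import Summits.QuantumFields.YangMills.Theorems.BalabanUVNodesN15KingModelCombesThomasLipschitz
import Summits.QuantumFields.YangMills.Theorems.BalabanUVNodesN15KingModelCombesThomasBlockField
import HarnessLib

/-!
# BalabanUVNodes ∕ N15 — THE KING-MODEL RUNG (PART Ϧ-h): THE BACKGROUND PROPAGATOR IS `η`-UNIFORMLY LIPSCHITZ IN THE FIELD ON BAŁABAN's SCALE `|U − V| ≤ ε₁η` — the form-bounded (`H¹`)
# currency: the hopping difference `Δ_U − Δ_V` is a COVARIANT GRADIENT times `U − V` plus `(U − V)(U − V)^*`, so `|⟨w,(A₀(U) − A₀(V))v⟩| ≤ (d+1)s²‖w‖‖v‖ + √(d+1)·s·(‖w‖·E_U(v)^{1∕2} +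
# E_U(w)^{1∕2}·‖v‖) + 2aDε‖w‖‖v‖` with `s = √c·ε` and `E_U` the covariant Dirichlet form; hence `‖G(U) − G(V)‖ ≤ 2√(d+1)·s∕κ^{3∕2} + (2(d+1)s² + 2aDε)∕κ²`; in King's scaling `s = Lε = ε∕η`
# (Track A, DAG node N15 = NE2; FAN-OUT v1.1 §N15 s3 «KING-MODEL RUNG … + what the curved case adds»; count-neutral)

EDITION v1.1 (DOC-ONLY, ERRATUM-Ϧ1, 2026-08-31): locators corrected after ref-J READ-769∕770 — [Balaban1985BackgroundPropagators] (3.37) is on p.396 (not p.397) and (3.48)–(3.50) span pp.398–400 (not p.398),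
verified first-hand on the held text (journal page = 388 + file page).  Declarations byte-identical to v1.0.

HONEST FRAMING.  Count-neutral (cell `pub-ymgap`, seat `pub-ymgap-dag-n15-e` g50; `--supports stmt-QuantumFields-27247 --as helper` = K3ᴬ, KEY MAP v3).  King's one-level comparison model, unitary
link fields, any fibre; OPERATOR-NORM (unweighted) conclusion.  This repairs the honest limitation recorded in PART Ϧ-f: the Lipschitz constant of `U ↦ G(U)` is uniform in the spacing when
the distance of the fields is measured on Bałaban's scale `‖U_b − V_b‖ ≤ ε₁∕L` ([Balaban1985BackgroundPropagators] (3.37): `|U − 1| ≤ εη`-type conditions), because the first-order part of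
`Δ_U − Δ_V` is relatively form-bounded by the covariant Dirichlet form.  NOT the weighted (decaying) version of this estimate (Ϧ-f has decay with the cruder constant); NOT analyticity
([Balaban1985BackgroundPropagators] Thm 3.4; PART Ϛ for the fine covariance); NOT a node discharge (N15 of record untouched); nothing continuum ∕ ℝ⁴ ∕ OS ∕ Clay.

THE RESULTS (`K` any torus in §1–§2; `E_U(v) := Σ_xΣ_μ‖v_x − U(x,μ)v_{x+e_μ}‖²` = Ϳ-b `bondE` summed; `N(v) = ‖v‖²`):
* (PART Ϧ-g, previous file: the bond-pair identity and ★★★ `norm_form_covLapF_sub_le`, `sqrt_dirichlet_le_of_near`.)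
* §3 `mul_dirichlet_le_re_quadForm_fullOpU` (`c·E_U(v) ≤ Re⟨v,A₀(U)v⟩`, `a, m² ≥ 0`), `wtConj_ctW_zero`, `lipschitz_bookkeeping`∕`'` (the real arithmetic), `fullOpU_sub_fullOpU`, `l2_opNorm_blockTerm_sub_le` (`≤ 2aDε`, Ϧ-f at
  zero weight), ★★★ `norm_form_fullOpU_inv_sub_le` (the bilinear estimate), ★★★★ **`l2_opNorm_fullOpU_inv_sub_le`** — unitary `U, V` with `‖U_b − V_b‖ ≤ ε` bondwise, both `A₀(U)`, `A₀(V)` `κ`-coercive, `a, c, m² ≥ 0`, contours of depth `≤ D`, `s := √c·ε`: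
  `‖G(U) − G(V)‖ ≤ 2√(d+1)·s∕(κ√κ) + (2(d+1)s² + 2aDε)∕κ²`; ★★★★ **`l2_opNorm_fullOpU_inv_sub_le_king`** (King's scaling `c = L²`, comb, `L ≥ 2`): `‖G(U) − G(V)‖ ≤ 2√(d+1)(Lε)∕(κ√κ) +
  2(d+1)((Lε)² + a(Lε))∕κ²` — a function of `Lε = ε∕η` ONLY: `η`-UNIFORMLY LIPSCHITZ on the scale `‖U − V‖ ≤ ε₁η`, for every `L ≥ 2`, every volume, every fibre.
PRIOR TREE ART (by name): Ϧ-a (`norm_le_of_reCoercive`, `isUnit_of_reCoercive`), Ϧ-e (`l2_opNorm_le_of_bilinear`), Ϧ-f (`inv_sub_inv_eq`, `l2_opNorm_wtConj_gram_sub_le`), Ϧ-g (`norm_form_covLapF_sub_le`, `sqrt_dirichlet_le_of_near`), Ϳ-b (`bondE`), Ϥ-d (`fullOpU`,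
`re_quadForm_fullOpU`, `isHermitian_fullOpU`), Ϥ-b (`kingComb_depth_le`), Ͱ-b∕Ͱ-f (`fib`, `sum_norm_fib_sq`, `sum_norm_fib_add_unitVec`, `norm_toEuclideanLin_of_mem_unitaryGroup`), Ͱ-q (`l2_opNorm_of_mem_unitaryGroup_le`),
`King1986.Torus.ctW`, Mathlib (`Finset.sum_mul_sq_le_sq_mul_sq`, `Matrix.l2_opNorm_mulVec`, `Matrix.l2_opNorm_conjTranspose`, `Matrix.IsHermitian.inv`).  Dedup (rg at filing): basename 0 files; needles
`lipschitz_bookkeeping|norm_form_fullOpU_inv_sub_le|l2_opNorm_fullOpU_inv_sub_le|l2_opNorm_blockTerm_sub_le` 0 tree files.  Locators: [Balaban1985BackgroundPropagators] (3.23)–(3.24) p.394, (3.37) p.396, (3.48)–(3.50)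
p.398 (Lipschitz∕holomorphic dependence of the propagators on `U` on the scale `εη` — the SHAPE decided here, one level, King's model); [King1986] (4.4)–(4.5) p.670.  0 `sorry`, 0 `def`.
-/

noncomputable section
open scoped BigOperators ComplexConjugate ComplexOrder InnerProductSpace Matrix.Norms.L2Operator
open Finset Matrix WithLp

namespace Summit.QuantumFields.YangMills.BalabanUVNodes.N15KingModelRung.CombesThomas

open Literature.MathematicalPhysics.QuantumFieldTheory.LatticeDiamagneticInequality (blk)
open Literature.MathematicalPhysics.QuantumFieldTheory.Balaban1983to89.B5Prop11Plancherel (Tor fine unitVec)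
open Literature.MathematicalPhysics.QuantumFieldTheory.King1986.Torus (ctW tdistT_self)
open Summit.QuantumFields.YangMills.BalabanUVNodes.N15KingModelRung.Covariant
  (covLapF fib fib_apply norm_apply_le_norm_fib sum_norm_fib_sq sum_norm_fib_add_unitVec norm_toEuclideanLin_of_mem_unitaryGroup norm_star_dotProduct_le re_star_dotProduct_le_norm_mul_norm
    l2_opNorm_of_mem_unitaryGroup_le)
open Summit.QuantumFields.YangMills.BalabanUVNodes.N15KingModelRung.Curvature (bondE)
open Summit.QuantumFields.YangMills.BalabanUVNodes.N15KingModelRung.CovariantBlock (BlockTree kingComb kingComb_depth_le covQ fullOpU re_quadForm_fullOpU isHermitian_fullOpU)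

variable {d : ℕ}
variable {𝕜 : Type*} [RCLike 𝕜] {n : Type*} [Fintype n] [DecidableEq n]

/-! ## §3 The `η`-uniform Lipschitz theorem -/

section Lipschitz

variable {L : ℕ} [NeZero L] (T : BlockTree d L) (M : Fin (d + 1) → ℕ) [hM : ∀ μ, NeZero (M μ)]

/-- `c·E_U(v) ≤ Re⟨v, A₀(U)v⟩` for `a, m² ≥ 0` (the form identity of PART Ϥ-d). [cite: King1986, (2.13) p.653, (4.5) p.670] -/
theorem mul_dirichlet_le_re_quadForm_fullOpU {a c m2 : ℝ} (ha : 0 ≤ a) (hm : 0 ≤ m2) {U : Tor (fine L M) × Fin (d + 1) → Matrix n n 𝕜} (hU : ∀ bd, U bd ∈ Matrix.unitaryGroup n 𝕜)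
    (v : Tor (fine L M) × n → 𝕜) : c * ∑ x, ∑ μ, bondE (fine L M) U v x μ ≤ RCLike.re (star v ⬝ᵥ (fullOpU T M a c m2 U *ᵥ v)) := by
  rw [re_quadForm_fullOpU T M a c m2 hU v]
  have h1 : 0 ≤ m2 * ∑ x, ‖fib (fine L M) v x‖ ^ 2 := mul_nonneg hm (Finset.sum_nonneg fun _ _ => sq_nonneg _)
  have h2 : 0 ≤ a * (L : ℝ) ^ (d + 1) * ∑ y, ‖fib M (covQ T M U *ᵥ v) y‖ ^ 2 := by positivity
  linarith

omit [Fintype n] [DecidableEq n] in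
/-- The zero weight is no conjugation: `X_{ctW 0} = X`. [folklore] -/
theorem wtConj_ctW_zero (x₀ : Tor (fine L M)) (X : Matrix (Tor (fine L M) × n) (Tor (fine L M) × n) 𝕜) : wtConj (fine L M) (ctW L M 0 x₀) X = X := by
  ext p q; rw [wtConj_apply, ctW, ctW, zero_div, zero_mul, zero_mul, sub_zero, Real.exp_zero, RCLike.ofReal_one, one_mul]

/-- THE BOOKKEEPING of the Lipschitz estimate (pure real arithmetic): with `P = N_f N_g`, the four size relations give the final constant. [folklore] -/
theorem lipschitz_bookkeeping {κ s aDε r Nf Ng Nw Nv Sv Sw : ℝ} (hκ : 0 < κ) (hs : 0 ≤ s) (haDε : 0 ≤ aDε) (hr : 0 ≤ r) (hNf : 0 ≤ Nf) (hNv : 0 ≤ Nv) (hSv0 : 0 ≤ Sv)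
    (hNw' : Nw ≤ Nf / κ) (hNv' : Nv ≤ Ng / κ) (hSv : Sv ≤ Ng / Real.sqrt κ) (hSw : Sw ≤ Nf / Real.sqrt κ + s * r * (Nf / κ)) :
    r ^ 2 * s ^ 2 * (Nw * Nv) + s * r * (Nw * Sv + Sw * Nv) + 2 * aDε * (Nw * Nv)
      ≤ (2 * r * s / (κ * Real.sqrt κ) + (2 * r ^ 2 * s ^ 2 + 2 * aDε) / κ ^ 2) * Nf * Ng := by
  have hsκ : 0 < Real.sqrt κ := Real.sqrt_pos.mpr hκ
  have k1 : Nw * Nv ≤ Nf * Ng / κ ^ 2 := by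
    have := mul_le_mul hNw' hNv' hNv (div_nonneg hNf hκ.le); rwa [div_mul_div_comm, ← sq] at this
  have k2 : Nw * Sv ≤ Nf * Ng / (κ * Real.sqrt κ) := by
    have := mul_le_mul hNw' hSv hSv0 (div_nonneg hNf hκ.le); rwa [div_mul_div_comm] at this
  have k3 : Sw * Nv ≤ Nf * Ng / (Real.sqrt κ * κ) + s * r * (Nf * Ng / (κ * κ)) := by
    have := mul_le_mul hSw hNv' hNv (by positivity)
    refine this.trans (le_of_eq ?_)
    rw [add_mul, div_mul_div_comm, mul_assoc (s * r), div_mul_div_comm]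
  have h0 : 0 ≤ r ^ 2 * s ^ 2 := by positivity
  have h1 : 0 ≤ s * r := by positivity
  have h2 : 0 ≤ 2 * aDε := by positivity
  calc r ^ 2 * s ^ 2 * (Nw * Nv) + s * r * (Nw * Sv + Sw * Nv) + 2 * aDε * (Nw * Nv)
      ≤ r ^ 2 * s ^ 2 * (Nf * Ng / κ ^ 2) + s * r * (Nf * Ng / (κ * Real.sqrt κ) + (Nf * Ng / (Real.sqrt κ * κ) + s * r * (Nf * Ng / (κ * κ)))) + 2 * aDε * (Nf * Ng / κ ^ 2) :=
        add_le_add (add_le_add (mul_le_mul_of_nonneg_left k1 h0) (mul_le_mul_of_nonneg_left (add_le_add k2 k3) h1)) (mul_le_mul_of_nonneg_left k1 h2)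
    _ = (2 * r * s / (κ * Real.sqrt κ) + (2 * r ^ 2 * s ^ 2 + 2 * aDε) / κ ^ 2) * Nf * Ng := by
        field_simp
        ring

/-- The same bookkeeping with the raw letters of §2 (`c = s_c²`, `dd = r²`). [folklore] -/
theorem lipschitz_bookkeeping' {κ c sc dd r ε aDε Nf Ng Nw Nv sEv sEw : ℝ} (hκ : 0 < κ) (hsc0 : 0 ≤ sc) (hsc : c = sc ^ 2) (hdd : dd = r ^ 2) (hr : 0 ≤ r) (hε : 0 ≤ ε)
    (haDε : 0 ≤ aDε) (hNf : 0 ≤ Nf) (hNv : 0 ≤ Nv) (hsEv : 0 ≤ sEv)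
    (hNw' : Nw ≤ Nf / κ) (hNv' : Nv ≤ Ng / κ) (hSv : sc * sEv ≤ Ng / Real.sqrt κ) (hSw : sc * sEw ≤ Nf / Real.sqrt κ + sc * ε * r * (Nf / κ)) :
    c * dd * ε ^ 2 * (Nw * Nv) + c * ε * r * (Nw * sEv + sEw * Nv) + 2 * aDε * (Nw * Nv)
      ≤ (2 * r * (sc * ε) / (κ * Real.sqrt κ) + (2 * dd * (sc * ε) ^ 2 + 2 * aDε) / κ ^ 2) * Nf * Ng := by
  subst hsc hdd
  have h := lipschitz_bookkeeping (s := sc * ε) (Sv := sc * sEv) (Sw := sc * sEw) hκ (by positivity) haDε hr hNf hNv (by positivity) hNw' hNv' hSv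
    (by calc sc * sEw ≤ Nf / Real.sqrt κ + sc * ε * r * (Nf / κ) := hSw
          _ = Nf / Real.sqrt κ + sc * ε * r * (Nf / κ) := rfl)
  calc sc ^ 2 * r ^ 2 * ε ^ 2 * (Nw * Nv) + sc ^ 2 * ε * r * (Nw * sEv + sEw * Nv) + 2 * aDε * (Nw * Nv)
      = r ^ 2 * (sc * ε) ^ 2 * (Nw * Nv) + sc * ε * r * (Nw * (sc * sEv) + sc * sEw * Nv) + 2 * aDε * (Nw * Nv) := by ring
    _ ≤ (2 * r * (sc * ε) / (κ * Real.sqrt κ) + (2 * r ^ 2 * (sc * ε) ^ 2 + 2 * aDε) / κ ^ 2) * Nf * Ng := h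

/-- `A₀(V) − A₀(U)` splits into the hopping difference and the block-term difference. [cite: King1986, (2.13) p.653] -/
theorem fullOpU_sub_fullOpU (a c m2 : ℝ) (U V : Tor (fine L M) × Fin (d + 1) → Matrix n n 𝕜) :
    fullOpU T M a c m2 V - fullOpU T M a c m2 U = (covLapF (fine L M) c m2 V - covLapF (fine L M) c m2 U)
      + ((((a * (L : ℝ) ^ (d + 1) : ℝ) : 𝕜) • ((covQ T M V)ᴴ * covQ T M V)) - (((a * (L : ℝ) ^ (d + 1) : ℝ) : 𝕜) • ((covQ T M U)ᴴ * covQ T M U))) := by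
  rw [fullOpU, fullOpU]; abel

/-- The block-term difference in operator norm: `‖aQ(V)^*Q(V) − aQ(U)^*Q(U)‖ ≤ 2aDε` (PART Ϧ-f at zero weight). [cite: Balaban1985BackgroundPropagators, (3.24) p.394] -/
theorem l2_opNorm_blockTerm_sub_le {D : ℕ} (hD : ∀ j, T.depth j ≤ D) {a : ℝ} (ha : 0 ≤ a) {U V : Tor (fine L M) × Fin (d + 1) → Matrix n n 𝕜}
    (hU : ∀ bd, U bd ∈ Matrix.unitaryGroup n 𝕜) (hV : ∀ bd, V bd ∈ Matrix.unitaryGroup n 𝕜) {ε : ℝ} (hε0 : 0 ≤ ε) (hε : ∀ bd, ‖U bd - V bd‖ ≤ ε) :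
    ‖(((a * (L : ℝ) ^ (d + 1) : ℝ) : 𝕜) • ((covQ T M V)ᴴ * covQ T M V)) - (((a * (L : ℝ) ^ (d + 1) : ℝ) : 𝕜) • ((covQ T M U)ᴴ * covQ T M U))‖ ≤ 2 * (a * D * ε) := by
  have h := l2_opNorm_wtConj_gram_sub_le T M hD hV hU hε0 (fun b => by rw [norm_sub_rev]; exact hε b) le_rfl (0 : Tor (fine L M))
  rw [wtConj_ctW_zero, Real.exp_zero, one_mul] at h
  rw [← smul_sub, show (((a * (L : ℝ) ^ (d + 1) : ℝ) : 𝕜)) = (a : 𝕜) * (((L : ℝ) ^ (d + 1) : ℝ) : 𝕜) by push_cast; ring, ← smul_smul, norm_smul, RCLike.norm_ofReal, abs_of_nonneg ha]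
  calc a * ‖(((L : ℝ) ^ (d + 1) : ℝ) : 𝕜) • ((covQ T M V)ᴴ * covQ T M V - (covQ T M U)ᴴ * covQ T M U)‖ ≤ a * (2 * D * ε) := mul_le_mul_of_nonneg_left h ha
    _ = 2 * (a * D * ε) := by ring

variable {a c m2 : ℝ} (ha : 0 ≤ a) (hc : 0 ≤ c) (hm : 0 ≤ m2) {D : ℕ} (hD : ∀ j, T.depth j ≤ D) {U V : Tor (fine L M) × Fin (d + 1) → Matrix n n 𝕜}
  (hU : ∀ bd, U bd ∈ Matrix.unitaryGroup n 𝕜) (hV : ∀ bd, V bd ∈ Matrix.unitaryGroup n 𝕜) {ε : ℝ} (hε0 : 0 ≤ ε) (hε : ∀ bd, ‖U bd - V bd‖ ≤ ε) {κ : ℝ} (hκ : 0 < κ)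
  (hcoU : ∀ v : Tor (fine L M) × n → 𝕜, κ * ∑ x, ‖fib (fine L M) v x‖ ^ 2 ≤ RCLike.re (star v ⬝ᵥ (fullOpU T M a c m2 U *ᵥ v)))
  (hcoV : ∀ v : Tor (fine L M) × n → 𝕜, κ * ∑ x, ‖fib (fine L M) v x‖ ^ 2 ≤ RCLike.re (star v ⬝ᵥ (fullOpU T M a c m2 V *ᵥ v)))
include ha hc hm hD hU hV hε0 hε hκ hcoU hcoV

/-- ★★★ **THE BILINEAR LIPSCHITZ ESTIMATE**: `|⟨f, (G(U) − G(V))g⟩| ≤ [2√(d+1)·s∕(κ√κ) + (2(d+1)s² + 2aDε)∕κ²]·‖f‖‖g‖`, `s = √c·ε` (resolvent identity, §2 on `w = G(U)f`, `v = G(V)g`, Lax–Milgram sizes).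
[cite: Balaban1985BackgroundPropagators, (3.48)–(3.50) pp.398–400 (shape); King1986, (4.5) p.670] -/
theorem norm_form_fullOpU_inv_sub_le (f g : Tor (fine L M) × n → 𝕜) :
    ‖star f ⬝ᵥ (((fullOpU T M a c m2 U)⁻¹ - (fullOpU T M a c m2 V)⁻¹) *ᵥ g)‖
      ≤ (2 * Real.sqrt ((d : ℝ) + 1) * (Real.sqrt c * ε) / (κ * Real.sqrt κ) + (2 * ((d : ℝ) + 1) * (Real.sqrt c * ε) ^ 2 + 2 * (a * D * ε)) / κ ^ 2)
        * ‖(toLp 2 f : EuclideanSpace 𝕜 (Tor (fine L M) × n))‖ * ‖(toLp 2 g : EuclideanSpace 𝕜 (Tor (fine L M) × n))‖ := by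
  have hUu : IsUnit (fullOpU T M a c m2 U) := isUnit_of_reCoercive (fine L M) hκ hcoU
  have hVu : IsUnit (fullOpU T M a c m2 V) := isUnit_of_reCoercive (fine L M) hκ hcoV
  have hUd : IsUnit (fullOpU T M a c m2 U).det := (Matrix.isUnit_iff_isUnit_det _).mp hUu
  have hVd : IsUnit (fullOpU T M a c m2 V).det := (Matrix.isUnit_iff_isUnit_det _).mp hVu
  have hGUh : ((fullOpU T M a c m2 U)⁻¹)ᴴ = (fullOpU T M a c m2 U)⁻¹ := (isHermitian_fullOpU T M a c m2 U).inv
  have hsκ0 : 0 < Real.sqrt κ := Real.sqrt_pos.mpr hκ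
  set w := (fullOpU T M a c m2 U)⁻¹ *ᵥ f with hw
  set v := (fullOpU T M a c m2 V)⁻¹ *ᵥ g with hv
  -- resolvent identity: `⟨f,(G_U − G_V)g⟩ = ⟨w, (A_V − A_U)v⟩`
  have hres : star f ⬝ᵥ (((fullOpU T M a c m2 U)⁻¹ - (fullOpU T M a c m2 V)⁻¹) *ᵥ g) = star w ⬝ᵥ ((fullOpU T M a c m2 V - fullOpU T M a c m2 U) *ᵥ v) := by
    rw [inv_sub_inv_eq (fine L M) hUu hVu, ← mulVec_mulVec, ← mulVec_mulVec, dotProduct_mulVec, star_mulVec, hGUh]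
  -- sizes of `w`, `v`
  have hAw : fullOpU T M a c m2 U *ᵥ w = f := by rw [hw, mulVec_mulVec, Matrix.mul_nonsing_inv _ hUd, Matrix.one_mulVec]
  have hAv : fullOpU T M a c m2 V *ᵥ v = g := by rw [hv, mulVec_mulVec, Matrix.mul_nonsing_inv _ hVd, Matrix.one_mulVec]
  have hNw' : ‖(toLp 2 w : EuclideanSpace 𝕜 (Tor (fine L M) × n))‖ ≤ ‖(toLp 2 f : EuclideanSpace 𝕜 (Tor (fine L M) × n))‖ / κ := by
    rw [le_div_iff₀ hκ, mul_comm]; have h := norm_le_of_reCoercive (fine L M) hcoU w; rwa [hAw] at h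
  have hNv' : ‖(toLp 2 v : EuclideanSpace 𝕜 (Tor (fine L M) × n))‖ ≤ ‖(toLp 2 g : EuclideanSpace 𝕜 (Tor (fine L M) × n))‖ / κ := by
    rw [le_div_iff₀ hκ, mul_comm]; have h := norm_le_of_reCoercive (fine L M) hcoV v; rwa [hAv] at h
  -- Dirichlet forms: `c·E ≤ Re⟨·,A·⟩ ≤ N·N' ≤ N'²/κ`, then square roots
  have hsqrt_form : ∀ {E N : ℝ}, 0 ≤ N → c * E ≤ N ^ 2 / κ → Real.sqrt c * Real.sqrt E ≤ N / Real.sqrt κ := by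
    intro E N hN h
    rw [← Real.sqrt_mul hc, show N / Real.sqrt κ = Real.sqrt (N ^ 2 / κ) by rw [Real.sqrt_div (sq_nonneg _), Real.sqrt_sq hN]]
    exact Real.sqrt_le_sqrt h
  have hEv : c * ∑ x, ∑ μ, bondE (fine L M) V v x μ ≤ ‖(toLp 2 g : EuclideanSpace 𝕜 (Tor (fine L M) × n))‖ ^ 2 / κ := by
    have h1 := mul_dirichlet_le_re_quadForm_fullOpU T M ha hm hV v (c := c) (m2 := m2)
    have h2 := re_star_dotProduct_le_norm_mul_norm (fine L M) v (fullOpU T M a c m2 V *ᵥ v)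
    have e : ‖(toLp 2 (fullOpU T M a c m2 V *ᵥ v) : EuclideanSpace 𝕜 (Tor (fine L M) × n))‖ = ‖(toLp 2 g : EuclideanSpace 𝕜 (Tor (fine L M) × n))‖ := by rw [hAv]
    rw [e] at h2
    have h3 := mul_le_mul_of_nonneg_right hNv' (norm_nonneg (toLp 2 g : EuclideanSpace 𝕜 (Tor (fine L M) × n)))
    rw [div_mul_eq_mul_div, ← sq] at h3
    linarith
  have hEw : c * ∑ x, ∑ μ, bondE (fine L M) U w x μ ≤ ‖(toLp 2 f : EuclideanSpace 𝕜 (Tor (fine L M) × n))‖ ^ 2 / κ := by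
    have h1 := mul_dirichlet_le_re_quadForm_fullOpU T M ha hm hU w (c := c) (m2 := m2)
    have h2 := re_star_dotProduct_le_norm_mul_norm (fine L M) w (fullOpU T M a c m2 U *ᵥ w)
    have e : ‖(toLp 2 (fullOpU T M a c m2 U *ᵥ w) : EuclideanSpace 𝕜 (Tor (fine L M) × n))‖ = ‖(toLp 2 f : EuclideanSpace 𝕜 (Tor (fine L M) × n))‖ := by rw [hAw]
    rw [e] at h2
    have h3 := mul_le_mul_of_nonneg_right hNw' (norm_nonneg (toLp 2 f : EuclideanSpace 𝕜 (Tor (fine L M) × n)))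
    rw [div_mul_eq_mul_div, ← sq] at h3
    linarith
  have hSv' := hsqrt_form (norm_nonneg _) hEv
  have hSw' : Real.sqrt c * Real.sqrt (∑ x, ∑ μ, bondE (fine L M) V w x μ)
      ≤ ‖(toLp 2 f : EuclideanSpace 𝕜 (Tor (fine L M) × n))‖ / Real.sqrt κ + Real.sqrt c * ε * Real.sqrt ((d : ℝ) + 1) * (‖(toLp 2 f : EuclideanSpace 𝕜 (Tor (fine L M) × n))‖ / κ) := by
    have h1 := sqrt_dirichlet_le_of_near (fine L M) hε0 hε w (U := U) (V := V)
    have h2 := hsqrt_form (norm_nonneg _) hEw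
    calc Real.sqrt c * Real.sqrt (∑ x, ∑ μ, bondE (fine L M) V w x μ)
        ≤ Real.sqrt c * (Real.sqrt (∑ x, ∑ μ, bondE (fine L M) U w x μ) + ε * Real.sqrt ((d : ℝ) + 1) * ‖(toLp 2 w : EuclideanSpace 𝕜 (Tor (fine L M) × n))‖) :=
          mul_le_mul_of_nonneg_left h1 (Real.sqrt_nonneg _)
      _ = Real.sqrt c * Real.sqrt (∑ x, ∑ μ, bondE (fine L M) U w x μ) + Real.sqrt c * ε * Real.sqrt ((d : ℝ) + 1) * ‖(toLp 2 w : EuclideanSpace 𝕜 (Tor (fine L M) × n))‖ := by ring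
      _ ≤ _ := add_le_add h2 (mul_le_mul_of_nonneg_left hNw' (by positivity))
  -- the two parts
  have hhop := norm_form_covLapF_sub_le (fine L M) hc m2 hV hU hε0 (fun b => by rw [norm_sub_rev]; exact hε b) w v
  have hblk : ‖star w ⬝ᵥ (((((a * (L : ℝ) ^ (d + 1) : ℝ) : 𝕜) • ((covQ T M V)ᴴ * covQ T M V)) - (((a * (L : ℝ) ^ (d + 1) : ℝ) : 𝕜) • ((covQ T M U)ᴴ * covQ T M U))) *ᵥ v)‖
      ≤ 2 * (a * D * ε) * (‖(toLp 2 w : EuclideanSpace 𝕜 (Tor (fine L M) × n))‖ * ‖(toLp 2 v : EuclideanSpace 𝕜 (Tor (fine L M) × n))‖) := by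
    refine (norm_star_dotProduct_le (fine L M) w _).trans ?_
    have h := (Matrix.l2_opNorm_mulVec ((((a * (L : ℝ) ^ (d + 1) : ℝ) : 𝕜) • ((covQ T M V)ᴴ * covQ T M V)) - (((a * (L : ℝ) ^ (d + 1) : ℝ) : 𝕜) • ((covQ T M U)ᴴ * covQ T M U)))
      (toLp 2 v : EuclideanSpace 𝕜 (Tor (fine L M) × n))).trans (mul_le_mul_of_nonneg_right (l2_opNorm_blockTerm_sub_le T M hD ha hU hV hε0 hε) (norm_nonneg _))
    have h' := mul_le_mul_of_nonneg_left h (norm_nonneg (toLp 2 w : EuclideanSpace 𝕜 (Tor (fine L M) × n)))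
    refine h'.trans (le_of_eq (by ring))
  rw [hres, fullOpU_sub_fullOpU, Matrix.add_mulVec, dotProduct_add]
  refine (norm_add_le _ _).trans ((add_le_add hhop hblk).trans ?_)
  exact lipschitz_bookkeeping' (sc := Real.sqrt c) (dd := (d : ℝ) + 1) (r := Real.sqrt ((d : ℝ) + 1)) hκ (Real.sqrt_nonneg _) (Real.sq_sqrt hc).symm
    (Real.sq_sqrt (by positivity)).symm (Real.sqrt_nonneg _) hε0 (by positivity) (norm_nonneg _) (norm_nonneg _) (Real.sqrt_nonneg _) hNw' hNv' hSv' hSw'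

/-- ★★★★ **THE BACKGROUND PROPAGATOR IS LIPSCHITZ IN THE FIELD, FORM-BOUNDED CURRENCY**: unitary `U, V` with `‖U_b − V_b‖ ≤ ε` on every bond, `A₀(U)` and `A₀(V)` both `κ`-coercive (`κ > 0`),
`a, c, m² ≥ 0`, contours of depth `≤ D`, `s := √c·ε`:  `‖G(U) − G(V)‖ ≤ 2√(d+1)·s∕(κ√κ) + (2(d+1)s² + 2aDε)∕κ²`.
[cite: Balaban1985BackgroundPropagators, (3.48)–(3.50) pp.398–400 (shape), (3.24) p.394; King1986, (4.5) p.670] -/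
theorem l2_opNorm_fullOpU_inv_sub_le :
    ‖(fullOpU T M a c m2 U)⁻¹ - (fullOpU T M a c m2 V)⁻¹‖
      ≤ 2 * Real.sqrt ((d : ℝ) + 1) * (Real.sqrt c * ε) / (κ * Real.sqrt κ) + (2 * ((d : ℝ) + 1) * (Real.sqrt c * ε) ^ 2 + 2 * (a * D * ε)) / κ ^ 2 :=
  l2_opNorm_le_of_bilinear ((fullOpU T M a c m2 U)⁻¹ - (fullOpU T M a c m2 V)⁻¹) (by positivity)
    (norm_form_fullOpU_inv_sub_le T M ha hc hm hD hU hV hε0 hε hκ hcoU hcoV)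

omit hD hc in
/-- ★★★★ **KING's SCALING: `η`-UNIFORM LIPSCHITZ DEPENDENCE ON BAŁABAN's SCALE** — `c = L²`, comb contours, `a, m² ≥ 0`, `L ≥ 2`; unitary `U, V` with `‖U_b − V_b‖ ≤ ε` on every bond and both
`A₀(U)`, `A₀(V)` `κ`-coercive:  `‖G(U) − G(V)‖ ≤ 2√(d+1)·(Lε)∕(κ√κ) + 2(d+1)·((Lε)² + a(Lε))∕κ²` — a function of `Lε = ε∕η` only: for fields at distance `ε₁η` the propagators differ by
`O(ε₁)` UNIFORMLY in the spacing, the volume and the fibre. [cite: Balaban1985BackgroundPropagators, (3.37) p.396, (3.48)–(3.50) pp.398–400 (shape); King1986, (4.5) p.670] -/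
theorem l2_opNorm_fullOpU_inv_sub_le_king (hT : T = kingComb d L) (hcL : c = (L : ℝ) ^ 2) :
    ‖(fullOpU T M a c m2 U)⁻¹ - (fullOpU T M a c m2 V)⁻¹‖
      ≤ 2 * Real.sqrt ((d : ℝ) + 1) * ((L : ℝ) * ε) / (κ * Real.sqrt κ) + 2 * ((d : ℝ) + 1) * (((L : ℝ) * ε) ^ 2 + a * ((L : ℝ) * ε)) / κ ^ 2 := by
  subst hT
  have hL0 : (0 : ℝ) ≤ L := Nat.cast_nonneg L
  have hc' : 0 ≤ c := by rw [hcL]; positivity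
  have hsq : Real.sqrt c = L := by rw [hcL, Real.sqrt_sq hL0]
  have h := l2_opNorm_fullOpU_inv_sub_le (kingComb d L) M ha hc' hm kingComb_depth_le hU hV hε0 hε hκ hcoU hcoV
  rw [hsq] at h
  refine h.trans (add_le_add le_rfl (div_le_div_of_nonneg_right ?_ (by positivity)))
  have hD : (((d + 1) * (L - 1) : ℕ) : ℝ) ≤ ((d : ℝ) + 1) * L := by
    have : (((L - 1 : ℕ)) : ℝ) ≤ L := by exact_mod_cast Nat.sub_le L 1
    push_cast; nlinarith
  nlinarith [mul_le_mul_of_nonneg_left hD (by positivity : (0 : ℝ) ≤ 2 * a * ε)]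

end Lipschitz

end Summit.QuantumFields.YangMills.BalabanUVNodes.N15KingModelRung.CombesThomas

end
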